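import Mathlib.Data.NNReal.Basic
import Literature.Computability.AlgebraicComplexity.GateQuotients
import Literature.Computability.AlgebraicComplexity.DepthReductionProofs
import HarnessLib

/-!
# The structure theorem for monotone arithmetic circuits computing set-multilinear polynomials

The decomposition theorem behind every monotone arithmetic-circuit lower bound for
set-multilinear ("ordered") polynomials, in the form used by
Chattopadhyay–Datta–Ghosal–Mukhopadhyay (ITCS 2022, arXiv:2109.06941), §2, Thm. 2.1 (there
attributed to Yehudayoff 2019): if a monotone circuit of size `s` computes an ordered polynomial
`p` with row set `[n]`, `n > 2`, then `p = Σ_t a_t · b_t` where `a_t`, `b_t` are monotone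
ordered polynomials with complementary row sets, `n/3 ≤ |I(a_t)| ≤ 2n/3`, and `a_t b_t ≤ p`
coefficientwise.

## What is here

* `rowDegrees m` (the row degrees of a monomial in doubly indexed variables `x_{i,j}`),
  `IsOrdered A f` (every monomial of `f` has degree one in each row of `A` and avoids the other
  rows — CDGM's ordered polynomials with `I(f) = A`), `IsFullyOrdered f` (set-multilinear).
* No-cancellation lemmas over the semiring `ℝ≥0` (`coeff_le_coeff_sum`, `add_mem_support_mul`)
  and the orderedness of the two factors of a nonzero product all of whose monomials are fully
  ordered (`exists_isOrdered_of_mul`, the remark "`I(a_s) ∩ I(b_s) = ∅`" of CDGM §3).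
* `DepthReduction.SLP.exists_balanced_decomposition`: the structure theorem for values of
  straight-line programs over `ℝ≥0` (the tree's `DepthReduction.SLP`; over `ℝ≥0` every program
  is monotone), and `ArithCircuit.exists_balanced_decomposition`, the same for fan-in-two
  circuits of the tree's `ArithCircuit ℝ≥0` model (via `DepthReduction.exists_slp`).

## Proof and the printed statement

The printed theorem has at most `s` terms and is proved by induction on the circuit. Here the
decomposition is read off the Valiant–Skyum–Berkowitz–Rackoff frontier identity already in the
tree (`DepthReduction.HomCircuit.val_eq_sum_frontier`, `GateQuotients.lean`): homogenize the
program in degree `n` (`SLP.homogenize`), expand the output along the frontier `F_m`,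
`m = ⌊2n/3⌋` — `p = Σ_{μ ∈ F_m} [p : μ] · [μ_light] · [μ_heavy]` — and put
`a_μ := [μ_heavy]`, `b_μ := [p : μ] · [μ_light]`. Over `ℝ≥0` nothing cancels, so every term is
coefficientwise below `p`; a nonzero term is then fully ordered, which forces its two factors to
be ordered with complementary row sets, and `|I(a_μ)| = deg μ_heavy ∈ ((m+1)/2, m]`, i.e.
`n/3 < |I(a_μ)| ≤ 2n/3`. The number of terms is the number of frontier nodes, at most the
number `4 s (n+1)²` of nodes of the homogenized program (`SLP.card_node_le`) instead of `s`;
every use of the theorem (counting or measure arguments giving `2^{Ω(n)}` bounds) is insensitive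
to this polynomial factor. The balance condition is stated as `n < 3|A| ∧ 3|A| ≤ 2n`.

## References

* [ChattopadhyayDattaGhosalMukhopadhyay2022] A. Chattopadhyay, R. Datta, U. Ghosal,
  P. Mukhopadhyay, *Monotone complexity of spanning tree polynomial re-visited*, ITCS 2022,
  §2 (ordered polynomials, Thm. 2.1), §3.
* [ValiantSkyumBerkowitzRackoff1983] gate quotients and the frontier identity (via
  `GateQuotients.lean`, [Tavenas2015] §5).
-/

noncomputable section

namespace Literature.Computability.AlgebraicComplexity

open MvPolynomial
open scoped NNReal

universe u v

variable {ι : Type u} {κ : Type v}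

/-- The *row degrees* of a monomial `m` in the doubly indexed variables `x_{i,j}`: the row `i`
gets the total degree of `m` in the variables `x_{i,j}`, `j` arbitrary. [folklore] -/
def rowDegrees (m : ι × κ →₀ ℕ) : ι →₀ ℕ :=
  Finsupp.mapDomain Prod.fst m

/-- Row degrees are additive. [folklore] -/
@[simp] theorem rowDegrees_add (m m' : ι × κ →₀ ℕ) :
    rowDegrees (m + m') = rowDegrees m + rowDegrees m' :=
  Finsupp.mapDomain_add

/-- Row degrees of the zero monomial. [folklore] -/
@[simp] theorem rowDegrees_zero : rowDegrees (0 : ι × κ →₀ ℕ) = 0 :=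
  Finsupp.mapDomain_zero

/-- Row degrees of a single variable. [folklore] -/
@[simp] theorem rowDegrees_single (p : ι × κ) (n : ℕ) :
    rowDegrees (Finsupp.single p n) = Finsupp.single p.1 n :=
  Finsupp.mapDomain_single

/-- The sum of the row degrees is the degree. [folklore] -/
theorem degree_rowDegrees (m : ι × κ →₀ ℕ) : (rowDegrees m).degree = m.degree :=
  Finsupp.degree_mapDomain _ _

/-- Over `ℝ≥0` there is no cancellation: a summand of a finite sum is coefficientwise below the
sum. [folklore] -/
theorem coeff_le_coeff_sum {α : Type*} (s : Finset α) (T : α → MvPolynomial (ι × κ) ℝ≥0)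
    {a : α} (ha : a ∈ s) (m : ι × κ →₀ ℕ) :
    coeff m (T a) ≤ coeff m (∑ b ∈ s, T b) := by
  rw [coeff_sum]
  exact Finset.single_le_sum (f := fun b => coeff m (T b)) (fun _ _ => zero_le) ha

/-- Over `ℝ≥0`, the product of a monomial of `f` and a monomial of `g` is a monomial of `f * g`.
[folklore] -/
theorem add_mem_support_mul {f g : MvPolynomial (ι × κ) ℝ≥0} {m m' : ι × κ →₀ ℕ}
    (hm : m ∈ f.support) (hm' : m' ∈ g.support) : m + m' ∈ (f * g).support := by
  classical
  rw [mem_support_iff] at hm hm' ⊢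
  rw [coeff_mul]
  intro h
  have h0 := (Finset.sum_eq_zero_iff.1 h) (m, m') (Finset.mem_antidiagonal.2 rfl)
  rcases mul_eq_zero.1 h0 with h1 | h1
  · exact hm h1
  · exact hm' h1

section Ordered

variable [DecidableEq ι]

/-- A polynomial in the variables `x_{i,j}` is *ordered with row set `A`* (set-multilinear on the
rows `A`; CDGM's ordered polynomials with `I(f) = A`) if every monomial in its support has degree
exactly one in each row `i ∈ A` and does not involve the other rows.
[cite: ChattopadhyayDattaGhosalMukhopadhyay2022, §2 (ordered polynomials)] -/
def IsOrdered (A : Finset ι) (f : MvPolynomial (ι × κ) ℝ≥0) : Prop :=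
  ∀ m ∈ f.support, ∀ i, rowDegrees m i = if i ∈ A then 1 else 0

/-- *Fully ordered* (set-multilinear): ordered with row set all of `ι`.
[cite: ChattopadhyayDattaGhosalMukhopadhyay2022, §2 (set-multilinear polynomials)] -/
def IsFullyOrdered (f : MvPolynomial (ι × κ) ℝ≥0) : Prop :=
  ∀ m ∈ f.support, ∀ i, rowDegrees m i = 1

/-- The zero polynomial is ordered for every row set. [folklore] -/
theorem isOrdered_zero (A : Finset ι) : IsOrdered A (0 : MvPolynomial (ι × κ) ℝ≥0) := by
  intro m hm; simp at hm

/-- **Orderedness of the factors.** If `f * g ≠ 0` has only fully ordered monomials then, over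
`ℝ≥0`, `f` is ordered with some row set `A` and `g` with the complementary row set.
[cite: ChattopadhyayDattaGhosalMukhopadhyay2022, §3 ("I(a_s) ∩ I(b_s) = ∅")] -/
theorem exists_isOrdered_of_mul [Fintype ι] {f g : MvPolynomial (ι × κ) ℝ≥0}
    (h : IsFullyOrdered (f * g)) (hfg : f * g ≠ 0) :
    ∃ A : Finset ι, IsOrdered A f ∧ IsOrdered Aᶜ g := by
  classical
  have hf : f ≠ 0 := fun h0 => hfg (by simp [h0])
  have hg : g ≠ 0 := fun h0 => hfg (by simp [h0])
  obtain ⟨m₀, hm₀⟩ := support_nonempty.2 hf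
  obtain ⟨m₀', hm₀'⟩ := support_nonempty.2 hg
  have key : ∀ m ∈ f.support, ∀ m' ∈ g.support, ∀ i,
      rowDegrees m i + rowDegrees m' i = 1 := by
    intro m hm m' hm' i
    have := h (m + m') (add_mem_support_mul hm hm') i
    simpa using this
  refine ⟨Finset.univ.filter fun i => rowDegrees m₀' i = 0, ?_, ?_⟩
  · intro m hm i
    have h1 := key m hm m₀' hm₀' i
    by_cases hi : rowDegrees m₀' i = 0
    · rw [if_pos (by simpa using hi)]; omega
    · rw [if_neg (by simpa using hi)]; omega
  · intro m' hm' i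
    have h1 := key m₀ hm₀ m' hm' i
    have h2 := key m₀ hm₀ m₀' hm₀' i
    by_cases hi : rowDegrees m₀' i = 0
    · rw [if_neg (by simpa using hi)]; omega
    · rw [if_pos (by simpa using hi)]; omega

/-- The row set of a nonzero ordered polynomial which is homogeneous of degree `e` has exactly `e`
elements. [folklore] -/
theorem card_eq_of_isOrdered [Fintype ι] {A : Finset ι} {f : MvPolynomial (ι × κ) ℝ≥0}
    (hA : IsOrdered A f) {e : ℕ} (hhom : f.IsHomogeneous e) (hf : f ≠ 0) :
    A.card = e := by
  classical
  obtain ⟨m, hm⟩ := support_nonempty.2 hf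
  have hdeg : m.degree = e := by
    rw [Finsupp.degree_apply]
    exact (hhom.degree_eq_sum_deg_support hm).symm
  have hsum : (rowDegrees m).degree = ∑ i, rowDegrees m i := Finsupp.degree_eq_sum _
  rw [← hdeg, ← degree_rowDegrees, hsum]
  simp_rw [hA m hm]
  rw [Finset.sum_boole]
  simp


omit [DecidableEq ι] in
/-- A fully ordered polynomial is homogeneous of degree the number of rows. [folklore] -/
theorem IsFullyOrdered.isHomogeneous [Fintype ι] {f : MvPolynomial (ι × κ) ℝ≥0}
    (hf : IsFullyOrdered f) : f.IsHomogeneous (Fintype.card ι) := by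
  intro m hm
  have hm' : m ∈ f.support := mem_support_iff.2 hm
  change Finsupp.weight (fun _ => 1) m = Fintype.card ι
  rw [← Finsupp.degree_eq_weight_one, ← degree_rowDegrees, Finsupp.degree_eq_sum]
  simp [hf m hm']

/-- A variable is not fully ordered once there are two rows. [folklore] -/
theorem not_isFullyOrdered_X [Fintype ι] (hn : 1 < Fintype.card ι) (j : ι × κ) :
    ¬ IsFullyOrdered (X j : MvPolynomial (ι × κ) ℝ≥0) := by
  intro h
  obtain ⟨i, hi⟩ := Fintype.exists_ne_of_one_lt_card hn j.1
  have := h (Finsupp.single j 1) (by simp [support_X]) i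
  rw [rowDegrees_single, Finsupp.single_apply, if_neg hi.symm] at this
  exact zero_ne_one this

omit [DecidableEq ι] in
/-- A nonzero constant is not fully ordered once there is a row. [folklore] -/
theorem not_isFullyOrdered_C [Nonempty ι] {c : ℝ≥0} (hc : c ≠ 0) :
    ¬ IsFullyOrdered (C c : MvPolynomial (ι × κ) ℝ≥0) := by
  intro h
  have := h 0 (by simp [support_C, hc]) (Classical.arbitrary ι)
  simp at this

end Ordered

/-! ### The structure theorem via gate quotients -/

section Structure

open DepthReduction

variable {k : Type u} [CommSemiring k] {σ : Type v}

/-- The values of the homogenized straight-line program are homogeneous of their formal degree.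
[cite: Tavenas2015, §4, Prop. 2] -/
theorem DepthReduction.SLP.isHomogeneous_homogenize_val (S : SLP k σ) (d : ℕ) (ν : S.Node d) :
    ((S.homogenize d).val ν).IsHomogeneous ((S.homogenize d).deg ν) := by
  obtain ⟨i, tg⟩ := ν
  cases tg with
  | U e => exact homogeneousComponent_isHomogeneous _ _
  | V e => exact homogeneousComponent_isHomogeneous _ _
  | R e a =>
    change (S.hval d (i, .R e a)).IsHomogeneous e.val
    rw [SLP.hval_R]
    split_ifs with hae
    · have := (homogeneousComponent_isHomogeneous a.val
        (S.opVal i.val (S.line i.val).fst)).mul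
        (homogeneousComponent_isHomogeneous (e.val - a.val) (S.opVal i.val (S.line i.val).snd))
      rwa [Nat.add_sub_cancel' hae] at this
    · exact isHomogeneous_zero _ _ _
  | Q e => exact homogeneousComponent_isHomogeneous _ _

end Structure

section StructureNNReal

open DepthReduction

variable [Fintype ι] [DecidableEq ι]

/-- **Structure theorem for monotone straight-line programs** (Yehudayoff 2019, as used in
CDGM 2022, Thm. 2.1; here in the Valiant–Skyum–Berkowitz–Rackoff form with a polynomial number
of terms). If a value `p` of a straight-line program of length `s` over the semiring `ℝ≥0` (every
such program is monotone) is fully ordered in `n ≥ 3` rows, then `p = Σ_t a_t · b_t` with at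
most `4 s (n+1)²` terms, where `a_t` is ordered with a row set `A_t` of size
`n/3 < |A_t| ≤ 2n/3`, `b_t` is ordered with the complementary row set, and `a_t b_t ≤ p`
coefficientwise. Proof: homogenize (`SLP.homogenize`), expand along the frontier
`F_{⌊2n/3⌋}` (`HomCircuit.val_eq_sum_frontier`), take `a_t` = value of the heavier child of the
frontier gate; no cancellation over `ℝ≥0` gives `a_t b_t ≤ p` and the orderedness.
[cite: ChattopadhyayDattaGhosalMukhopadhyay2022, §2, Thm. 2.1] -/
theorem DepthReduction.SLP.exists_balanced_decomposition (S : SLP ℝ≥0 (ι × κ)) {i : ℕ}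
    (hi : i < S.len) (hord : IsFullyOrdered (S.val i)) (hn : 3 ≤ Fintype.card ι) :
    ∃ L : List (Finset ι × MvPolynomial (ι × κ) ℝ≥0 × MvPolynomial (ι × κ) ℝ≥0),
      L.length ≤ 4 * S.len * (Fintype.card ι + 1) ^ 2 ∧
      (L.map fun t => t.2.1 * t.2.2).sum = S.val i ∧
      ∀ t ∈ L, IsOrdered t.1 t.2.1 ∧ IsOrdered t.1ᶜ t.2.2 ∧
        Fintype.card ι < 3 * t.1.card ∧ 3 * t.1.card ≤ 2 * Fintype.card ι ∧
        ∀ m, coeff m (t.2.1 * t.2.2) ≤ coeff m (S.val i) := by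
  classical
  set n := Fintype.card ι with hn_def
  set p := S.val i with hp_def
  -- the homogenized program and the output node
  set H := S.homogenize n with hH
  let α : S.Node n := (⟨i, hi⟩, SLP.Tag.Q (Fin.last n))
  have hhom : p.IsHomogeneous n := hord.isHomogeneous
  have hval : H.val α = p := by
    change S.hval n (⟨i, hi⟩, SLP.Tag.Q (Fin.last n)) = p
    rw [SLP.hval_Q]
    exact homogeneousComponent_eq_self hhom
  have hdegα : H.deg α = n := rfl
  set m := 2 * n / 3 with hm_def
  have hm1 : 1 ≤ m := by omega
  have hmn : m < H.deg α := by rw [hdegα]; omega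
  have key := H.val_eq_sum_frontier hm1 hmn
  rw [hval] at key
  -- the factors attached to a frontier gate
  let hv : S.Node n → S.Node n := fun μ => H.heavy (H.children μ).1 (H.children μ).2
  let lt : S.Node n → S.Node n := fun μ => H.light (H.children μ).1 (H.children μ).2
  let a : S.Node n → MvPolynomial (ι × κ) ℝ≥0 := fun μ => H.val (hv μ)
  let b : S.Node n → MvPolynomial (ι × κ) ℝ≥0 := fun μ => H.quot α μ * H.val (lt μ)
  have hterm : ∀ μ ∈ H.frontier m, H.quot α μ * H.val μ = a μ * b μ := by
    intro μ hμ
    obtain ⟨hk, -, -, -⟩ := H.of_mem_frontier hμ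
    change H.quot α μ * H.val μ = H.val (hv μ) * (H.quot α μ * H.val (lt μ))
    rw [H.val_prod_eq hk]
    ring
  have key' : p = ∑ μ ∈ H.frontier m, a μ * b μ := key.trans (Finset.sum_congr rfl hterm)
  set T := (H.frontier m).filter fun μ => a μ * b μ ≠ 0 with hT
  have hsumT : ∑ μ ∈ T, a μ * b μ = p := by
    rw [hT, Finset.sum_filter_ne_zero, ← key']
  have hle : ∀ μ ∈ T, ∀ mm, coeff mm (a μ * b μ) ≤ coeff mm p := by
    intro μ hμ mm
    rw [← hsumT]
    exact coeff_le_coeff_sum T (fun μ => a μ * b μ) hμ mm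
  have hfo : ∀ μ ∈ T, IsFullyOrdered (a μ * b μ) := by
    intro μ hμ mm hmm
    apply hord mm
    rw [mem_support_iff] at hmm ⊢
    exact fun h0 => hmm (le_antisymm ((hle μ hμ mm).trans h0.le) zero_le)
  have hex : ∀ μ ∈ T, ∃ A : Finset ι, IsOrdered A (a μ) ∧ IsOrdered Aᶜ (b μ) := by
    intro μ hμ
    exact exists_isOrdered_of_mul (hfo μ hμ) (Finset.mem_filter.1 hμ).2
  choose! A hA using hex
  -- balance of the row sets
  have hcard : ∀ μ ∈ T, n < 3 * (A μ).card ∧ 3 * (A μ).card ≤ 2 * n := by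
    intro μ hμ
    have hμF : μ ∈ H.frontier m := (Finset.mem_filter.1 hμ).1
    have hne : a μ * b μ ≠ 0 := (Finset.mem_filter.1 hμ).2
    have ha0 : a μ ≠ 0 := fun h0 => hne (by rw [h0, zero_mul])
    obtain ⟨hk, hdμ, h1, h2⟩ := H.of_mem_frontier hμF
    have hc : (A μ).card = H.deg (hv μ) :=
      card_eq_of_isOrdered (hA μ hμ).1 (S.isHomogeneous_homogenize_val n (hv μ)) ha0
    have hdeg := H.deg_prod_eq hk
    have hll := H.deg_light_le (H.children μ).1 (H.children μ).2
    have hhm := H.deg_heavy_le_of h1 h2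
    change H.deg μ = H.deg (lt μ) + H.deg (hv μ) at hdeg
    change H.deg (lt μ) ≤ H.deg (hv μ) at hll
    change H.deg (hv μ) ≤ m at hhm
    rw [hc]
    omega
  refine ⟨T.toList.map fun μ => (A μ, a μ, b μ), ?_, ?_, ?_⟩
  · rw [List.length_map, Finset.length_toList]
    exact (Finset.card_le_univ T).trans (S.card_node_le n)
  · rw [List.map_map, ← hsumT, ← Finset.sum_map_toList]
    rfl
  · intro t ht
    obtain ⟨μ, hμ, rfl⟩ := List.mem_map.1 ht
    rw [Finset.mem_toList] at hμ
    exact ⟨(hA μ hμ).1, (hA μ hμ).2, (hcard μ hμ).1, (hcard μ hμ).2, hle μ hμ⟩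

/-- **Structure theorem for monotone arithmetic circuits** (the tree's `ArithCircuit` over the
semiring `ℝ≥0`, fan-in two, size `s` = number of gates): a fully ordered polynomial in `n ≥ 3`
rows computed by such a circuit is a sum of at most `4 s (n+1)²` nearly balanced ordered
products dominated by it. [cite: ChattopadhyayDattaGhosalMukhopadhyay2022, §2, Thm. 2.1] -/
theorem ArithCircuit.exists_balanced_decomposition (P : ArithCircuit ℝ≥0 (ι × κ))
    (hP : P.IsFanInTwo) {p : MvPolynomial (ι × κ) ℝ≥0} (hc : P.Computes p)
    (hord : IsFullyOrdered p) (hn : 3 ≤ Fintype.card ι) :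
    ∃ L : List (Finset ι × MvPolynomial (ι × κ) ℝ≥0 × MvPolynomial (ι × κ) ℝ≥0),
      L.length ≤ 4 * P.size * (Fintype.card ι + 1) ^ 2 ∧
      (L.map fun t => t.2.1 * t.2.2).sum = p ∧
      ∀ t ∈ L, IsOrdered t.1 t.2.1 ∧ IsOrdered t.1ᶜ t.2.2 ∧
        Fintype.card ι < 3 * t.1.card ∧ 3 * t.1.card ≤ 2 * Fintype.card ι ∧
        ∀ m, coeff m (t.2.1 * t.2.2) ≤ coeff m p := by
  obtain ⟨S, hlen, h⟩ := DepthReduction.exists_slp P hP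
  unfold ArithCircuit.Computes at hc
  rcases h with ⟨i, hi, hval⟩ | ⟨j, hj⟩ | ⟨c, hcC⟩
  · rw [← hc, hval, ← hlen]
    rw [← hc, hval] at hord
    exact S.exists_balanced_decomposition hi hord hn
  · rw [← hc, hj] at hord
    exact absurd hord (not_isFullyOrdered_X (by omega) j)
  · by_cases hc0 : c = 0
    · refine ⟨[], by simp, ?_, by simp⟩
      rw [← hc, hcC, hc0]; simp
    · haveI : Nonempty ι := Fintype.card_pos_iff.1 (by omega)
      rw [← hc, hcC] at hord
      exact absurd hord (not_isFullyOrdered_C hc0)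

end StructureNNReal

end Literature.Computability.AlgebraicComplexity
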